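import Summits.Langlands.Langlands.Theses.TriangulineChamber

/-!
# Birth skeleton (BC3) for piece `GalRepRegularHilbert` of the decomposition of `LiftB2CrysRamifiedP`
(stmt-Langlands-8574, crux-strategist).  The piece is restated verbatim as a local `def` (it is not
yet a route declaration); `stub_*` are the registered stubs (sorried); `GalRepRegularHilbert_of` is proved.
-/

set_option linter.dupNamespace false

namespace Summit.Langlands.Langlands.Cruxes.LiftB2CrysRamifiedP.BirthGalRepRegularHilbert

open Summit.Langlands Summit.Langlands.Langlands.Theses.TriangulineChamber
open scoped Matrix Classical
open Filter Set Function

/-- piece GalRepRegularHilbert (verbatim; child of LiftB2CrysRamifiedP in the strategist split). -/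
def GalRepRegularHilbert : Prop :=
  ∀ (F : Type) [Field F] [NumberField F] [NumberField.IsTotallyReal F], ∃ RD : ReciprocityData F, ∀ hcpt : Literature.NumberTheory.Automorphic.isCompact_glFiniteIntegralLevel 2 F, ∀ π : Literature.NumberTheory.Automorphic.CuspidalAutomorphicRepData 2 F hcpt, π.1.IsLAlgebraic → (∃ T : Literature.NumberTheory.Automorphic.InfinityType F 2, π.1.HasInfinityType T ∧ T.IsRegular) → ∀ (ℓ : ℕ) [Fact ℓ.Prime] (ι : PadicAlgCl ℓ ≃+* ℂ), ∃ ρ : Literature.NumberTheory.GaloisRepresentations.FramedGaloisRep F (PadicAlgCl ℓ) 2, ρ.toGaloisRep.IsIrreducible ∧ IsGeometricFramed RD ρ ∧ Corresponds RD ι π.1 ρ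

/-- **Galois representations of regular Hilbert cusp forms, almost-everywhere form** (stub):
for `F` totally real and `π` cuspidal, `L`-algebraic with a regular infinity type
(`π ⊗ |det|^{1/2}` = a Hilbert eigenform of weights `k_σ ≥ 2`), for every `ℓ`, `ι` there is an
IRREDUCIBLE `ρ : Γ_F → GL₂(ℚ̄_ℓ)` attached to `π` at almost all places (Satake–Frobenius,
`L`-normalisation).  Carayol 1986, Taylor 1989, Blasius–Rogawski 1993 (existence; tree fact
`exists_galoisRep_of_regularAlgebraic`, lang.S27, for the `C`-normalised semisimple `r`), Ribet /
Taylor (irreducibility of `ρ_{π,ι}` for cuspidal `π` of regular weight). -/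
theorem stub_exists_irreducible_satakeAE :
    ∀ (F : Type) [Field F] [NumberField F] [NumberField.IsTotallyReal F] (hcpt :
      Literature.NumberTheory.Automorphic.isCompact_glFiniteIntegralLevel 2 F) (π :
      Literature.NumberTheory.Automorphic.CuspidalAutomorphicRepData 2 F hcpt), π.1.IsLAlgebraic
      → (∃ T : Literature.NumberTheory.Automorphic.InfinityType F 2, π.1.HasInfinityType T ∧
      T.IsRegular) → ∀ (ℓ : ℕ) [Fact ℓ.Prime] (ι : PadicAlgCl ℓ ≃+* ℂ), ∃ ρ :
      Literature.NumberTheory.GaloisRepresentations.FramedGaloisRep F (PadicAlgCl ℓ) 2,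
      ρ.toGaloisRep.IsIrreducible ∧ ∀ᶠ v : IsDedekindDomain.HeightOneSpectrum
      (NumberField.RingOfIntegers F) in Filter.cofinite, SatakeFrobCompatibleAt ι π.1 ρ v := by
  sorry

/-- **Local–global compatibility at every finite place, with the datum it pins** (stub): for `F`
totally real there are reciprocity data `RD` (Harris–Taylor's `rec_v` at every `v`) such that every
irreducible `ρ` attached at almost all places to a regular `L`-algebraic cuspidal `π` (so
`ρ ≅ ρ_{π,ι}`) is geometric (de Rham at `v ∣ ℓ`: Faltings/Tsuji for the Blasius–Rogawski motive,
Saito 2009) and satisfies `Corresponds RD ι π ρ`: compatibility at `v ∤ ℓ` (Carayol 1986) and at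
`v ∣ ℓ` (Saito 2009, Skinner 2009, T. Liu 2012) through Fontaine's pinned `D_pst` datum.  Needs a
term of `ReciprocityData F` (`LocalLanglandsDatum.nonempty`). -/
theorem stub_exists_RD_compatible :
    ∀ (F : Type) [Field F] [NumberField F] [NumberField.IsTotallyReal F], ∃ RD :
      ReciprocityData F, ∀ (hcpt :
      Literature.NumberTheory.Automorphic.isCompact_glFiniteIntegralLevel 2 F) (π :
      Literature.NumberTheory.Automorphic.CuspidalAutomorphicRepData 2 F hcpt), π.1.IsLAlgebraic
      → (∃ T : Literature.NumberTheory.Automorphic.InfinityType F 2, π.1.HasInfinityType T ∧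
      T.IsRegular) → ∀ (ℓ : ℕ) [Fact ℓ.Prime] (ι : PadicAlgCl ℓ ≃+* ℂ) (ρ :
      Literature.NumberTheory.GaloisRepresentations.FramedGaloisRep F (PadicAlgCl ℓ) 2),
      ρ.toGaloisRep.IsIrreducible → (∀ᶠ v : IsDedekindDomain.HeightOneSpectrum
      (NumberField.RingOfIntegers F) in Filter.cofinite, SatakeFrobCompatibleAt ι π.1 ρ v) →
      IsGeometricFramed RD ρ ∧ Corresponds RD ι π.1 ρ := by
  sorry

/-- The piece from the two stubs. -/
theorem GalRepRegularHilbert_of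
    (h1 : ∀ (F : Type) [Field F] [NumberField F] [NumberField.IsTotallyReal F] (hcpt :
      Literature.NumberTheory.Automorphic.isCompact_glFiniteIntegralLevel 2 F) (π :
      Literature.NumberTheory.Automorphic.CuspidalAutomorphicRepData 2 F hcpt), π.1.IsLAlgebraic
      → (∃ T : Literature.NumberTheory.Automorphic.InfinityType F 2, π.1.HasInfinityType T ∧
      T.IsRegular) → ∀ (ℓ : ℕ) [Fact ℓ.Prime] (ι : PadicAlgCl ℓ ≃+* ℂ), ∃ ρ :
      Literature.NumberTheory.GaloisRepresentations.FramedGaloisRep F (PadicAlgCl ℓ) 2,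
      ρ.toGaloisRep.IsIrreducible ∧ ∀ᶠ v : IsDedekindDomain.HeightOneSpectrum
      (NumberField.RingOfIntegers F) in Filter.cofinite, SatakeFrobCompatibleAt ι π.1 ρ v)
    (h2 : ∀ (F : Type) [Field F] [NumberField F] [NumberField.IsTotallyReal F], ∃ RD :
      ReciprocityData F, ∀ (hcpt :
      Literature.NumberTheory.Automorphic.isCompact_glFiniteIntegralLevel 2 F) (π :
      Literature.NumberTheory.Automorphic.CuspidalAutomorphicRepData 2 F hcpt), π.1.IsLAlgebraic
      → (∃ T : Literature.NumberTheory.Automorphic.InfinityType F 2, π.1.HasInfinityType T ∧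
      T.IsRegular) → ∀ (ℓ : ℕ) [Fact ℓ.Prime] (ι : PadicAlgCl ℓ ≃+* ℂ) (ρ :
      Literature.NumberTheory.GaloisRepresentations.FramedGaloisRep F (PadicAlgCl ℓ) 2),
      ρ.toGaloisRep.IsIrreducible → (∀ᶠ v : IsDedekindDomain.HeightOneSpectrum
      (NumberField.RingOfIntegers F) in Filter.cofinite, SatakeFrobCompatibleAt ι π.1 ρ v) →
      IsGeometricFramed RD ρ ∧ Corresponds RD ι π.1 ρ) :
    GalRepRegularHilbert := by
  intro F _ _ _
  obtain ⟨RD, hRD⟩ := h2 F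
  refine ⟨RD, fun hcpt π hL hreg ℓ _ ι => ?_⟩
  obtain ⟨ρ, hirr, hsat⟩ := h1 F hcpt π hL hreg ℓ ι
  obtain ⟨hgeom, hcorr⟩ := hRD hcpt π hL hreg ℓ ι ρ hirr hsat
  exact ⟨ρ, hirr, hgeom, hcorr⟩

end Summit.Langlands.Langlands.Cruxes.LiftB2CrysRamifiedP.BirthGalRepRegularHilbert
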